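import Literature.Topology.FourManifolds.MazurDoubleCancellation
import Literature.Topology.FourManifolds.HCobordismAuxiliaryPairProofs
import Literature.Topology.FourManifolds.HCobordismAdjustField
import Literature.Topology.FourManifolds.HomotopicCirclesIsotopic
import HarnessLib

/-!
# Mazur doubles, V: the cancelling position of the `(1, 2)` pair from the ideal circle and the
# homotopy of the attaching circle (Milnor 1965, §8: Thm. 8.4 with Remark, Thm. 5.8, Lemma 4.7)

Companion of `MazurDoubleCancellation.lean`, which proves Mazur's theorem
(`Mazur1961_double_sphere_four`) from the hypothesis `hcan`: *for every nice Morse function on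
the triad `(V; ∅, ∂V)` of a compact contractible `5`-manifold with boundary whose critical points
are `m, p, q` of indices `0, 1, 2`, some smooth gradient-like field has `S_R(p)` and `S_L(q)`
meeting in the level `V₁₊` in a single point, transversely.*  This file **proves `hcan` from two
inputs**, again spelled out as hypotheses (no named fact is minted, D-0026):

* `hideal` — **the ideal circle** (Milnor 1965, Lemma 8.3, for the triad `(V; ∅, ∂V)` with its
  index-`0` point): in the level `V₁₊ = g⁻¹(plusLevel 4 1)`, presented by a closed `4`-manifold
  `V₁`, there is a smoothly embedded circle `S` meeting the right-hand `3`-sphere `S_R(p)`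
  in exactly one point, transversely.  (The tree proves this for cobordisms from a connected
  non-empty incoming end without critical points of index `0`,
  `Cobordism.Milnor1965_exists_circle_transverse_rightHandSphere_holds`; the variant for
  `(V; ∅, ∂V)`, where the level `V₀₊ ≅ S⁴` above the minimum replaces the incoming end, is the
  subject of a sequel file.)
* `hcrux` — **Mazur's homotopy** (Mazur 1961: *"the attaching curve of the 2-handle is
  homotopic in `∂(S¹ × B⁴)` to `S¹ × pt`"*, from the contractibility of `W`): the left-hand
  circle `C = S_L(q) ∩ V₁₊` of `q`, as an embedded circle `e_C : S¹ → V₁`, is homotopic to a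
  smooth reparametrisation of the ideal circle `S`.

From these, along Milnor's proof of Thm. 8.1 Index 1 (PDF p. 56, the tree's
`Cobordism.Milnor1965_exists_auxiliaryPair_of_parts`, whose bookkeeping is repeated here one
level lower, between `V₁₊` and `q`): homotopic embedded circles in the closed `4`-manifold `V₁`
are smoothly isotopic (Whitney 1936; Milnor's Thm. 8.4 with its Remark `n ≥ 2m + 2`,
`isSmoothlyIsotopic_circle_of_homotopic`), a smooth isotopy of a circle is ambient (Thm. 5.8,
`isAmbientIsotopic_of_isSmoothlyIsotopic_euclidean`), and Lemma 4.7 to the right of `V₁₊`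
(`Cobordism.Milnor1965_adjust_field_right_holds`, on the slab between `V₁₊` and a level below
`q`) realises the end diffeomorphism `h` of the ambient isotopy by a new gradient-like field
`ξ₁`, equal to the old one off that slab: the right-hand sphere of `p` in `V₁₊` is unchanged and
the new left-hand sphere of `q` in `V₁₊` is `h(C) = S`, which meets `S_R(p)` in one point,
transversely.  Everything here is **proved**:

* `cancellingPosition_of_idealCircle_of_homotopic` — `hcan` from `hideal` and `hcrux`;
* `nonempty_diffeomorph_closedBall_of_hasHandleDecomposition_oneOneOne_five_of_idealCircle_of_homotopic`,
  `Mazur1961_double_sphere_four_of_idealCircle_of_homotopic` — the `5`-ball and Mazur's theorem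
  from `hideal` and `hcrux` (by `MazurDoubleCancellation.lean`).

## References

* B. Mazur, *A note on some contractible 4-manifolds*, Ann. of Math. 73 (1961), 221–228,
  proof of the Theorem. [Mazur1961]
* J. Milnor, *Lectures on the h-cobordism theorem*, notes by L. Siebenmann and J. Sondow,
  Princeton (1965): Def. 3.9 (PDF p. 16), Lemma 4.7 (PDF p. 25), Thm. 5.8 (PDF p. 34), Lemma 8.3,
  Thm. 8.4 and Remark, proof of Thm. 8.1 Index 1 (PDF pp. 55–56). [MilnorHCobordism1965]
* H. Whitney, *Differentiable manifolds*, Ann. of Math. 37 (1936), §II Thm. 6. [Whitney1936]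
-/

noncomputable section

open scoped Manifold ContDiff Topology ContinuousMap
open Set Function Filter

namespace Literature.Topology.FourManifolds

/-- **The cancelling position of the `(1, 2)` pair from the ideal circle and Mazur's homotopy**
(Milnor 1965, proof of Thm. 8.1 Index 1, PDF p. 56, run between `V₁₊` and the index-`2` point:
Thm. 8.4 with Remark, Thm. 5.8, Lemma 4.7).  Given, for every nice Morse function `g` on the
triad `(V; ∅, ∂V)` of a compact `5`-manifold with boundary with critical points `m, p, q` of
indices `0, 1, 2`, every smooth gradient-like `ξ` and every presentation `ι₁ : V₁ ↪ V` of the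
level `V₁₊`:

* `hideal`: an embedded circle `e : S¹ → V₁` whose image meets `S_R(p)` in exactly one point
  `x₀`, transversely in the level;
* `hcrux` (for contractible `V`): if `e_C : S¹ → V₁` is an embedded circle onto the left-hand
  sphere of `q` in `V₁₊` and `e_S` one as in `hideal`, then `e_C` is homotopic to a smooth
  embedding `e` with the same image as `e_S`;

then for contractible `V` some smooth gradient-like field `ξ₁` for `g` has
`S_R(p) ∩ S_L(q) = {x₀}` in `V₁₊`, transversely.  Proof: the left-hand sphere of `q` in `V₁₊` is
an embedded circle `e_C` (Def. 3.9, `Cobordism.Milnor1965_leftHandSphere_embedded_holds`);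
`e_C` and `e` are smoothly isotopic (Whitney, `isSmoothlyIsotopic_circle_of_homotopic`), hence
ambient isotopic by an isotopy `F` of `V₁` (Thm. 5.8, `isAmbientIsotopic_of_isSmoothlyIsotopic_euclidean`);
Lemma 4.7 on the slab `g⁻¹[plusLevel 4 1, bm]`, `bm < g q`
(`Cobordism.Milnor1965_adjust_field_right_holds`) gives `ξ₁ = ξ` off that slab with translation
`h ∘ φ`, `h = F₁`; so `S_R(p)` in `V₁₊` is unchanged, and the new left-hand sphere of `q` in
`V₁₊` — the translate of the unchanged one in the level `bm` — is `h(C) = S`.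
[cite: MilnorHCobordism1965, proof of Thm. 8.1 Index 1 (PDF p. 56), Thm. 8.4 and Remark, Thm. 5.8 (PDF p. 34), Lemma 4.7 (PDF p. 25), Def. 3.9 (PDF p. 16)]
[cite: Whitney1936, §II Thm. 6] [cite: Mazur1961, Theorem (W × I ≅ I⁵), proof] -/
theorem cancellingPosition_of_idealCircle_of_homotopic
    (hideal : ∀ (V : Type) [TopologicalSpace V] [T2Space V] [SecondCountableTopology V]
      [ChartedSpace (EuclideanHalfSpace (4 + 1)) V] [IsManifold (𝓡∂ (4 + 1)) ∞ V] [CompactSpace V]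
      (g : V → ℝ), (Cobordism.ofBoundary 4 V).IsNiceMorseFunction g →
      ∀ (m p q : V), criticalSet (𝓡∂ (4 + 1)) g = {m, p, q} →
      morseIndex (𝓡∂ (4 + 1)) g m = 0 → morseIndex (𝓡∂ (4 + 1)) g p = 1 →
      morseIndex (𝓡∂ (4 + 1)) g q = 2 →
      ∀ (ξ : Cₛ^∞⟮𝓡∂ (4 + 1); EuclideanSpace ℝ (Fin (4 + 1)),
          (TangentSpace (𝓡∂ (4 + 1)) : V → Type)⟯), IsGradientLike (𝓡∂ (4 + 1)) g ξ →
      ∀ (V₁ : Type) [TopologicalSpace V₁] [T2Space V₁] [SecondCountableTopology V₁]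
        [CompactSpace V₁] [ChartedSpace (EuclideanSpace ℝ (Fin 4)) V₁] [IsManifold (𝓡 4) ∞ V₁]
        (ι₁ : V₁ → V), Manifold.IsSmoothEmbedding (𝓡 4) (𝓡∂ (4 + 1)) ∞ ι₁ →
        range ι₁ = g ⁻¹' {Cobordism.plusLevel 4 1} →
      ∃ e : C((Metric.sphere (0 : EuclideanSpace ℝ (Fin 2)) 1), V₁), Manifold.IsSmoothEmbedding (𝓡 1) (𝓡 4) ∞ e ∧ ∃ x₀ : V,
        rightHandSphere (𝓡∂ (4 + 1)) g ξ p (Cobordism.plusLevel 4 1) ∩ (ι₁ '' range e) = {x₀} ∧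
        IsTransverseInLevel (𝓡∂ (4 + 1)) (g ⁻¹' {Cobordism.plusLevel 4 1})
          (rightHandSphere (𝓡∂ (4 + 1)) g ξ p (Cobordism.plusLevel 4 1)) (ι₁ '' range e) x₀)
    (hcrux : ∀ (V : Type) [TopologicalSpace V] [T2Space V] [SecondCountableTopology V]
      [ChartedSpace (EuclideanHalfSpace (4 + 1)) V] [IsManifold (𝓡∂ (4 + 1)) ∞ V] [CompactSpace V]
      [ContractibleSpace V] (g : V → ℝ), (Cobordism.ofBoundary 4 V).IsNiceMorseFunction g →
      ∀ (m p q : V), criticalSet (𝓡∂ (4 + 1)) g = {m, p, q} →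
      morseIndex (𝓡∂ (4 + 1)) g m = 0 → morseIndex (𝓡∂ (4 + 1)) g p = 1 →
      morseIndex (𝓡∂ (4 + 1)) g q = 2 →
      ∀ (ξ : Cₛ^∞⟮𝓡∂ (4 + 1); EuclideanSpace ℝ (Fin (4 + 1)),
          (TangentSpace (𝓡∂ (4 + 1)) : V → Type)⟯), IsGradientLike (𝓡∂ (4 + 1)) g ξ →
      ∀ (V₁ : Type) [TopologicalSpace V₁] [T2Space V₁] [SecondCountableTopology V₁]
        [CompactSpace V₁] [ChartedSpace (EuclideanSpace ℝ (Fin 4)) V₁] [IsManifold (𝓡 4) ∞ V₁]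
        (ι₁ : V₁ → V), Manifold.IsSmoothEmbedding (𝓡 4) (𝓡∂ (4 + 1)) ∞ ι₁ →
        range ι₁ = g ⁻¹' {Cobordism.plusLevel 4 1} →
      ∀ (e_C : C((Metric.sphere (0 : EuclideanSpace ℝ (Fin 2)) 1), V₁)), Manifold.IsSmoothEmbedding (𝓡 1) (𝓡 4) ∞ e_C →
        range (ι₁ ∘ e_C) = leftHandSphere (𝓡∂ (4 + 1)) g ξ q (Cobordism.plusLevel 4 1) →
      ∀ (e_S : C((Metric.sphere (0 : EuclideanSpace ℝ (Fin 2)) 1), V₁)), Manifold.IsSmoothEmbedding (𝓡 1) (𝓡 4) ∞ e_S → ∀ (x₀ : V),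
        rightHandSphere (𝓡∂ (4 + 1)) g ξ p (Cobordism.plusLevel 4 1) ∩ (ι₁ '' range e_S) = {x₀} →
        IsTransverseInLevel (𝓡∂ (4 + 1)) (g ⁻¹' {Cobordism.plusLevel 4 1})
          (rightHandSphere (𝓡∂ (4 + 1)) g ξ p (Cobordism.plusLevel 4 1)) (ι₁ '' range e_S) x₀ →
      ∃ e : C((Metric.sphere (0 : EuclideanSpace ℝ (Fin 2)) 1), V₁), Manifold.IsSmoothEmbedding (𝓡 1) (𝓡 4) ∞ e ∧ range e = range e_S ∧
        e_C.Homotopic e)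
    (V : Type) [TopologicalSpace V] [T2Space V] [SecondCountableTopology V]
    [ChartedSpace (EuclideanHalfSpace (4 + 1)) V] [IsManifold (𝓡∂ (4 + 1)) ∞ V] [CompactSpace V]
    [ContractibleSpace V] (g : V → ℝ) (hg : (Cobordism.ofBoundary 4 V).IsNiceMorseFunction g)
    (m p q : V) (hcrit : criticalSet (𝓡∂ (4 + 1)) g = {m, p, q})
    (hm : morseIndex (𝓡∂ (4 + 1)) g m = 0) (hp : morseIndex (𝓡∂ (4 + 1)) g p = 1)
    (hq : morseIndex (𝓡∂ (4 + 1)) g q = 2) :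
    ∃ (ξ : Cₛ^∞⟮𝓡∂ (4 + 1); EuclideanSpace ℝ (Fin (4 + 1)), (TangentSpace (𝓡∂ (4 + 1)) : V → Type)⟯)
      (x₀ : V), IsGradientLike (𝓡∂ (4 + 1)) g ξ ∧
      rightHandSphere (𝓡∂ (4 + 1)) g ξ p (Cobordism.plusLevel 4 1) ∩
        leftHandSphere (𝓡∂ (4 + 1)) g ξ q (Cobordism.plusLevel 4 1) = {x₀} ∧
      IsTransverseInLevel (𝓡∂ (4 + 1)) (g ⁻¹' {Cobordism.plusLevel 4 1})
        (rightHandSphere (𝓡∂ (4 + 1)) g ξ p (Cobordism.plusLevel 4 1))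
        (leftHandSphere (𝓡∂ (4 + 1)) g ξ q (Cobordism.plusLevel 4 1)) x₀ := by
  haveI : CompactSpace ((𝓡∂ (4 + 1)).boundary V) := compactSpace_boundary 4 V
  -- levels
  have hLP : ∀ k, Cobordism.niceLevel 4 k < Cobordism.plusLevel 4 k := Cobordism.niceLevel_lt_plusLevel 4
  have hPL : ∀ k, Cobordism.plusLevel 4 k < Cobordism.niceLevel 4 (k + 1) :=
    Cobordism.plusLevel_lt_niceLevel_succ 4
  have h00 : Cobordism.niceLevel 4 0 < Cobordism.plusLevel 4 0 := hLP 0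
  have h01 : Cobordism.plusLevel 4 0 < Cobordism.niceLevel 4 1 := hPL 0
  have h11 : Cobordism.niceLevel 4 1 < Cobordism.plusLevel 4 1 := hLP 1
  have h12 : Cobordism.plusLevel 4 1 < Cobordism.niceLevel 4 2 := hPL 1
  have h22 : Cobordism.niceLevel 4 2 < Cobordism.plusLevel 4 2 := hLP 2
  have h23 : Cobordism.plusLevel 4 2 < Cobordism.niceLevel 4 3 := hPL 2
  have hL3 : Cobordism.niceLevel 4 3 < 1 := Cobordism.niceLevel_lt_one (by norm_num)
  have hP1pos : 0 < Cobordism.plusLevel 4 1 := (Cobordism.niceLevel_pos 4 1).trans h11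
  have hP11 : Cobordism.plusLevel 4 1 < 1 := (h12.trans h22).trans (h23.trans hL3)
  -- values of the critical points
  have hval : ∀ z ∈ criticalSet (𝓡∂ (4 + 1)) g,
      g z = Cobordism.niceLevel 4 (morseIndex (𝓡∂ (4 + 1)) g z) := fun z hz => hg.2 z hz
  have hmc : m ∈ criticalSet (𝓡∂ (4 + 1)) g := by rw [hcrit]; exact mem_insert m _
  have hpc : p ∈ criticalSet (𝓡∂ (4 + 1)) g := by rw [hcrit]; exact Or.inr (mem_insert p _)
  have hqc : q ∈ criticalSet (𝓡∂ (4 + 1)) g := by rw [hcrit]; exact Or.inr (Or.inr rfl)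
  have hmval : g m = Cobordism.niceLevel 4 0 := by rw [hval m hmc, hm]
  have hpval : g p = Cobordism.niceLevel 4 1 := by rw [hval p hpc, hp]
  have hqval : g q = Cobordism.niceLevel 4 2 := by rw [hval q hqc, hq]
  have hPq : Cobordism.plusLevel 4 1 < g q := by rw [hqval]; exact h12
  have hgd : MDifferentiable (𝓡∂ (4 + 1)) 𝓘(ℝ, ℝ) g :=
    hg.1.isMorse.contMDiff.mdifferentiable (by simp)
  -- the level `V₁₊` as a closed manifold
  have h1 : IsRegularLevel (𝓡∂ (4 + 1)) g (Cobordism.plusLevel 4 1) :=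
    hg.1.isRegularLevel ⟨hP1pos, hP11⟩ fun z hz h =>
      hg.not_isMCriticalPt_of_apply_eq_plusLevel h hz
  ----------------------------------------------------------------------------------------------
  -- Step 1: a gradient-like field, the ideal circle `e_S`, the left-hand circle `e_C`
  ----------------------------------------------------------------------------------------------
  obtain ⟨ξ, hξ⟩ : ∃ ξ : Cₛ^∞⟮𝓡∂ (4 + 1); EuclideanSpace ℝ (Fin (4 + 1)),
      (TangentSpace (𝓡∂ (4 + 1)) : V → Type)⟯, IsGradientLike (𝓡∂ (4 + 1)) g ξ :=
    Cobordism.Milnor1965_exists_isGradientLike_holds hg.1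
  have hnn : ∀ w, 0 ≤ mlineDeriv (𝓡∂ (4 + 1)) g w (ξ w) :=
    mlineDeriv_nonneg_of_pos_of_not_isMCriticalPt hξ.mlineDeriv_pos
  obtain ⟨e_S, he_S, x₀, hx₀, htr⟩ := hideal V g hg m p q hcrit hm hp hq ξ hξ (RegularLevel h1)
    (RegularLevel.incl h1) (RegularLevel.isSmoothEmbedding_incl h1) (RegularLevel.range_incl h1)
  -- no critical value of `g` in `[plusLevel 4 1, g q)`
  have hfree : ∀ w ∈ criticalSet (𝓡∂ (4 + 1)) g, g w ∉ Ico (Cobordism.plusLevel 4 1) (g q) := by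
    intro w hw hwI
    have hw' := hw
    rw [hcrit] at hw'
    rcases hw' with rfl | rfl | rfl
    · rw [hmval] at hwI; exact absurd hwI.1 (not_le.2 (h00.trans (h01.trans h11)))
    · rw [hpval] at hwI; exact absurd hwI.1 (not_le.2 h11)
    · exact lt_irrefl _ hwI.2
  obtain ⟨e_C, he_C, hS_C⟩ : ∃ e : C((Metric.sphere (0 : EuclideanSpace ℝ (Fin 2)) 1), RegularLevel h1),
      Manifold.IsSmoothEmbedding (𝓡 1) (𝓡 4) ∞ e ∧
      range (RegularLevel.incl h1 ∘ e) = leftHandSphere (𝓡∂ (4 + 1)) g ξ q (Cobordism.plusLevel 4 1) :=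
    Cobordism.Milnor1965_leftHandSphere_embedded_holds hg.1 ξ hξ (k := 1)
      ⟨hqc, hq⟩ hP1pos hPq hfree (RegularLevel h1) (RegularLevel.incl h1)
      (RegularLevel.isSmoothEmbedding_incl h1) (RegularLevel.range_incl h1)
  ----------------------------------------------------------------------------------------------
  -- Step 2 (Mazur's homotopy; Thm. 8.4 with Remark; Thm. 5.8): an ambient isotopy `F` of `V₁₊`
  -- with `F₁ ∘ e_C = e`, `range e = range e_S`.
  ----------------------------------------------------------------------------------------------
  obtain ⟨e, he, hrange, hhom⟩ := hcrux V g hg m p q hcrit hm hp hq ξ hξ (RegularLevel h1)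
    (RegularLevel.incl h1) (RegularLevel.isSmoothEmbedding_incl h1) (RegularLevel.range_incl h1)
    e_C he_C hS_C e_S he_S x₀ hx₀ htr
  obtain ⟨F, hF⟩ : IsAmbientIsotopic (𝓡 1) (𝓡 4) e_C e :=
    isAmbientIsotopic_of_isSmoothlyIsotopic_euclidean (⇑e_C) (⇑e)
      (isSmoothlyIsotopic_circle_of_homotopic (n := 4) le_rfl e_C e he_C he hhom)
  ----------------------------------------------------------------------------------------------
  -- Step 3 (Lemma 4.7 to the right of `V₁₊`): the new field `ξ₁`.
  ----------------------------------------------------------------------------------------------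
  set bm : ℝ := (Cobordism.plusLevel 4 1 + g q) / 2 with hbmdef
  have hbm1 : Cobordism.plusLevel 4 1 < bm := by rw [hbmdef]; linarith
  have hbm2 : bm < g q := by rw [hbmdef]; linarith
  have hbm3 : bm < 1 := hbm2.trans (by rw [hqval]; exact h22.trans (h23.trans hL3))
  have hfree' : ∀ w ∈ criticalSet (𝓡∂ (4 + 1)) g, g w ∉ Icc (Cobordism.plusLevel 4 1) bm :=
    fun w hw hwI => hfree w hw ⟨hwI.1, hwI.2.trans_lt hbm2⟩
  obtain ⟨ξ₁, hξ₁, hξ₁eq, hpush, hpull⟩ :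
      ∃ ξ' : Cₛ^∞⟮𝓡∂ (4 + 1); EuclideanSpace ℝ (Fin (4 + 1)), (TangentSpace (𝓡∂ (4 + 1)) : V → Type)⟯,
        IsGradientLike (𝓡∂ (4 + 1)) g ξ' ∧
        (∀ z, g z ∉ Ioo (Cobordism.plusLevel 4 1) bm → ξ' z = ξ z) ∧
        (∀ x, g x = bm → ∀ v : RegularLevel h1, FlowsTo (𝓡∂ (4 + 1)) ξ (RegularLevel.incl h1 v) x →
          FlowsTo (𝓡∂ (4 + 1)) ξ' (RegularLevel.incl h1 (F.toFun 1 v)) x) ∧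
        (∀ x, g x = bm → ∀ v : RegularLevel h1, FlowsTo (𝓡∂ (4 + 1)) ξ' (RegularLevel.incl h1 v) x →
          ∃ v₀ : RegularLevel h1, F.toFun 1 v₀ = v ∧ FlowsTo (𝓡∂ (4 + 1)) ξ (RegularLevel.incl h1 v₀) x) :=
    Cobordism.Milnor1965_adjust_field_right_holds hg.1 ξ hξ
      hP1pos hbm1 hbm3 hfree' (RegularLevel h1) (RegularLevel.incl h1)
      (RegularLevel.isSmoothEmbedding_incl h1) (RegularLevel.range_incl h1) F
  have hnn₁ : ∀ w, 0 ≤ mlineDeriv (𝓡∂ (4 + 1)) g w (ξ₁ w) :=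
    mlineDeriv_nonneg_of_pos_of_not_isMCriticalPt hξ₁.mlineDeriv_pos
  -- the two fields agree below `V₁₊` and above the level `bm`
  have hlow : ∀ w, g w ≤ Cobordism.plusLevel 4 1 → ξ₁ w = ξ w := fun w hw =>
    hξ₁eq w fun h => (not_lt.2 hw) h.1
  have hhigh : ∀ w, bm ≤ g w → ξ₁ w = ξ w := fun w hw =>
    hξ₁eq w fun h => (not_le.2 h.2) hw
  ----------------------------------------------------------------------------------------------
  -- The spheres.  (i) The right-hand sphere of `p` in `V₁₊` is unchanged.
  ----------------------------------------------------------------------------------------------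
  have hSR : rightHandSphere (𝓡∂ (4 + 1)) g ξ₁ p (Cobordism.plusLevel 4 1) =
      rightHandSphere (𝓡∂ (4 + 1)) g ξ p (Cobordism.plusLevel 4 1) := by
    ext x
    simp only [mem_rightHandSphere_iff]
    constructor
    · rintro ⟨hx, hx1⟩
      refine ⟨mem_unstableSet_of_field_eq_of_apply_le hgd hnn₁ (a := Cobordism.plusLevel 4 1)
        (fun w hw => (hlow w hw).symm) hx ?_, hx1⟩
      exact le_of_eq hx1
    · rintro ⟨hx, hx1⟩
      refine ⟨mem_unstableSet_of_field_eq_of_apply_le hgd hnn (a := Cobordism.plusLevel 4 1)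
        hlow hx ?_, hx1⟩
      exact le_of_eq hx1
  ----------------------------------------------------------------------------------------------
  -- (ii) The left-hand sphere of `q` in `V₁₊` for `ξ₁` is `h(C) = S` (Lemma 4.7 (b)).
  ----------------------------------------------------------------------------------------------
  -- the left-hand sphere `Σ` of `q` in the level `bm` is the same for `ξ` and `ξ₁`
  have hSig : leftHandSphere (𝓡∂ (4 + 1)) g ξ₁ q bm = leftHandSphere (𝓡∂ (4 + 1)) g ξ q bm := by
    ext x
    simp only [mem_leftHandSphere_iff]
    constructor
    · rintro ⟨hx, hxb⟩
      exact ⟨mem_stableSet_of_field_eq_of_le_apply hgd hnn₁ (a := bm)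
        (fun w hw => (hhigh w hw).symm) hx hxb.ge, hxb⟩
    · rintro ⟨hx, hxb⟩
      exact ⟨mem_stableSet_of_field_eq_of_le_apply hgd hnn (a := bm) hhigh hx hxb.ge, hxb⟩
  -- left-hand spheres in `V₁₊` are the translates of `Σ`
  have key : ∀ (ζ : Π w : V, TangentSpace (𝓡∂ (4 + 1)) w) (x : V),
      x ∈ leftHandSphere (𝓡∂ (4 + 1)) g ζ q (Cobordism.plusLevel 4 1) ↔
        g x = Cobordism.plusLevel 4 1 ∧
        ∃ x' ∈ leftHandSphere (𝓡∂ (4 + 1)) g ζ q bm, FlowsTo (𝓡∂ (4 + 1)) ζ x x' := by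
    intro ζ x
    constructor
    · rintro ⟨hx, hx2⟩
      obtain ⟨y, hy, hflow, hyst⟩ := exists_flowsTo_of_mem_stableSet hgd hx (b := bm)
        (by rw [hx2]; exact hbm1.le) hbm2
      exact ⟨hx2, y, ⟨hyst, hy⟩, hflow⟩
    · rintro ⟨hx2, x', ⟨hx'st, -⟩, hflow⟩
      exact ⟨hflow.mem_stableSet hx'st, hx2⟩
  have hincl_inj : Injective (RegularLevel.incl h1) := Subtype.val_injective
  have hlev : ∀ v : RegularLevel h1, g (RegularLevel.incl h1 v) = Cobordism.plusLevel 4 1 :=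
    fun v => RegularLevel.apply_incl h1 v
  have hT : ∀ v : RegularLevel h1, (∃ x' ∈ leftHandSphere (𝓡∂ (4 + 1)) g ξ q bm,
      FlowsTo (𝓡∂ (4 + 1)) ξ (RegularLevel.incl h1 v) x') ↔ v ∈ range e_C := by
    intro v
    have h1' : RegularLevel.incl h1 v ∈ leftHandSphere (𝓡∂ (4 + 1)) g ξ q (Cobordism.plusLevel 4 1) ↔
        v ∈ range e_C := by
      rw [← hS_C]
      constructor
      · rintro ⟨s, hs⟩; exact ⟨s, hincl_inj hs⟩
      · rintro ⟨s, rfl⟩; exact ⟨s, rfl⟩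
    rw [← h1', key]
    simp only [hlev v, true_and]
  have hSL : leftHandSphere (𝓡∂ (4 + 1)) g ξ₁ q (Cobordism.plusLevel 4 1) =
      RegularLevel.incl h1 '' range e := by
    ext x
    constructor
    · intro hx
      have hx2 : g x = Cobordism.plusLevel 4 1 := hx.2
      obtain ⟨v, rfl⟩ : x ∈ range (RegularLevel.incl h1) := by
        rw [RegularLevel.range_incl]; exact hx2
      obtain ⟨-, x', hx'S, hflow⟩ := (key _ _).1 hx
      rw [hSig] at hx'S
      obtain ⟨v₀, hv₀, hflow₀⟩ := hpull x' hx'S.2 v hflow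
      obtain ⟨s, hs⟩ := (hT v₀).1 ⟨x', hx'S, hflow₀⟩
      refine ⟨e s, ⟨s, rfl⟩, ?_⟩
      rw [← hv₀, ← hs, show F.toFun 1 (e_C s) = e s from congrFun hF s]
    · rintro ⟨v, ⟨s, rfl⟩, rfl⟩
      obtain ⟨x', hx'S, hflow⟩ := (hT (e_C s)).2 ⟨s, rfl⟩
      have hflow₁ := hpush x' hx'S.2 (e_C s) hflow
      rw [show F.toFun 1 (e_C s) = e s from congrFun hF s] at hflow₁
      exact (key _ _).2 ⟨hlev _, x', by rw [hSig]; exact hx'S, hflow₁⟩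
  have hSL' : leftHandSphere (𝓡∂ (4 + 1)) g ξ₁ q (Cobordism.plusLevel 4 1) =
      RegularLevel.incl h1 '' range e_S := by rw [hSL, hrange]
  ----------------------------------------------------------------------------------------------
  -- Conclusion.
  ----------------------------------------------------------------------------------------------
  refine ⟨ξ₁, x₀, hξ₁, ?_, ?_⟩
  · rw [hSR, hSL']; exact hx₀
  · rw [hSR, hSL']; exact htr

/-- **The `5`-ball from the ideal circle and Mazur's homotopy**: a compact contractible
`5`-manifold with one handle of each index `0, 1, 2` is diffeomorphic to `𝔻⁵`, given `hideal`
and `hcrux` (see `cancellingPosition_of_idealCircle_of_homotopic`), by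
`nonempty_diffeomorph_closedBall_of_hasHandleDecomposition_oneOneOne_five_of_cancellingPosition`.
[cite: Mazur1961, Theorem (W × I ≅ I⁵), proof] [cite: MilnorHCobordism1965, Thm. 5.4 (PDF p. 27) and §8 (PDF pp. 54–57)] -/
theorem nonempty_diffeomorph_closedBall_of_hasHandleDecomposition_oneOneOne_five_of_idealCircle_of_homotopic
    (hideal : ∀ (V : Type) [TopologicalSpace V] [T2Space V] [SecondCountableTopology V]
      [ChartedSpace (EuclideanHalfSpace (4 + 1)) V] [IsManifold (𝓡∂ (4 + 1)) ∞ V] [CompactSpace V]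
      (g : V → ℝ), (Cobordism.ofBoundary 4 V).IsNiceMorseFunction g →
      ∀ (m p q : V), criticalSet (𝓡∂ (4 + 1)) g = {m, p, q} →
      morseIndex (𝓡∂ (4 + 1)) g m = 0 → morseIndex (𝓡∂ (4 + 1)) g p = 1 →
      morseIndex (𝓡∂ (4 + 1)) g q = 2 →
      ∀ (ξ : Cₛ^∞⟮𝓡∂ (4 + 1); EuclideanSpace ℝ (Fin (4 + 1)),
          (TangentSpace (𝓡∂ (4 + 1)) : V → Type)⟯), IsGradientLike (𝓡∂ (4 + 1)) g ξ →
      ∀ (V₁ : Type) [TopologicalSpace V₁] [T2Space V₁] [SecondCountableTopology V₁]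
        [CompactSpace V₁] [ChartedSpace (EuclideanSpace ℝ (Fin 4)) V₁] [IsManifold (𝓡 4) ∞ V₁]
        (ι₁ : V₁ → V), Manifold.IsSmoothEmbedding (𝓡 4) (𝓡∂ (4 + 1)) ∞ ι₁ →
        range ι₁ = g ⁻¹' {Cobordism.plusLevel 4 1} →
      ∃ e : C((Metric.sphere (0 : EuclideanSpace ℝ (Fin 2)) 1), V₁), Manifold.IsSmoothEmbedding (𝓡 1) (𝓡 4) ∞ e ∧ ∃ x₀ : V,
        rightHandSphere (𝓡∂ (4 + 1)) g ξ p (Cobordism.plusLevel 4 1) ∩ (ι₁ '' range e) = {x₀} ∧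
        IsTransverseInLevel (𝓡∂ (4 + 1)) (g ⁻¹' {Cobordism.plusLevel 4 1})
          (rightHandSphere (𝓡∂ (4 + 1)) g ξ p (Cobordism.plusLevel 4 1)) (ι₁ '' range e) x₀)
    (hcrux : ∀ (V : Type) [TopologicalSpace V] [T2Space V] [SecondCountableTopology V]
      [ChartedSpace (EuclideanHalfSpace (4 + 1)) V] [IsManifold (𝓡∂ (4 + 1)) ∞ V] [CompactSpace V]
      [ContractibleSpace V] (g : V → ℝ), (Cobordism.ofBoundary 4 V).IsNiceMorseFunction g →
      ∀ (m p q : V), criticalSet (𝓡∂ (4 + 1)) g = {m, p, q} →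
      morseIndex (𝓡∂ (4 + 1)) g m = 0 → morseIndex (𝓡∂ (4 + 1)) g p = 1 →
      morseIndex (𝓡∂ (4 + 1)) g q = 2 →
      ∀ (ξ : Cₛ^∞⟮𝓡∂ (4 + 1); EuclideanSpace ℝ (Fin (4 + 1)),
          (TangentSpace (𝓡∂ (4 + 1)) : V → Type)⟯), IsGradientLike (𝓡∂ (4 + 1)) g ξ →
      ∀ (V₁ : Type) [TopologicalSpace V₁] [T2Space V₁] [SecondCountableTopology V₁]
        [CompactSpace V₁] [ChartedSpace (EuclideanSpace ℝ (Fin 4)) V₁] [IsManifold (𝓡 4) ∞ V₁]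
        (ι₁ : V₁ → V), Manifold.IsSmoothEmbedding (𝓡 4) (𝓡∂ (4 + 1)) ∞ ι₁ →
        range ι₁ = g ⁻¹' {Cobordism.plusLevel 4 1} →
      ∀ (e_C : C((Metric.sphere (0 : EuclideanSpace ℝ (Fin 2)) 1), V₁)), Manifold.IsSmoothEmbedding (𝓡 1) (𝓡 4) ∞ e_C →
        range (ι₁ ∘ e_C) = leftHandSphere (𝓡∂ (4 + 1)) g ξ q (Cobordism.plusLevel 4 1) →
      ∀ (e_S : C((Metric.sphere (0 : EuclideanSpace ℝ (Fin 2)) 1), V₁)), Manifold.IsSmoothEmbedding (𝓡 1) (𝓡 4) ∞ e_S → ∀ (x₀ : V),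
        rightHandSphere (𝓡∂ (4 + 1)) g ξ p (Cobordism.plusLevel 4 1) ∩ (ι₁ '' range e_S) = {x₀} →
        IsTransverseInLevel (𝓡∂ (4 + 1)) (g ⁻¹' {Cobordism.plusLevel 4 1})
          (rightHandSphere (𝓡∂ (4 + 1)) g ξ p (Cobordism.plusLevel 4 1)) (ι₁ '' range e_S) x₀ →
      ∃ e : C((Metric.sphere (0 : EuclideanSpace ℝ (Fin 2)) 1), V₁), Manifold.IsSmoothEmbedding (𝓡 1) (𝓡 4) ∞ e ∧ range e = range e_S ∧
        e_C.Homotopic e)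
    (W : Type) [TopologicalSpace W] [T2Space W] [SecondCountableTopology W]
    [ChartedSpace (EuclideanHalfSpace (4 + 1)) W] [IsManifold (𝓡∂ (4 + 1)) ∞ W] [CompactSpace W]
    [ContractibleSpace W] (hW : HasHandleDecomposition 4 W (fun k => if k ≤ 2 then 1 else 0)) :
    Nonempty (W ≃ₘ⟮𝓡∂ (4 + 1), 𝓡∂ (4 + 1)⟯
      Metric.closedBall (0 : EuclideanSpace ℝ (Fin (4 + 1))) 1) :=
  nonempty_diffeomorph_closedBall_of_hasHandleDecomposition_oneOneOne_five_of_cancellingPosition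
    (fun V _ _ _ _ _ _ _ g hg m p q hcrit hm hp hq =>
      cancellingPosition_of_idealCircle_of_homotopic hideal hcrux V g hg m p q hcrit hm hp hq) W hW

/-- **Mazur's theorem (the double of a Mazur manifold is `S⁴`) from the ideal circle and Mazur's
homotopy** (Mazur 1961, Theorem and Corollary 1; Aitchison–Rubinstein 1984, Lemma 5.4): by
`Mazur1961_double_sphere_four_of_cancellingPosition` (`MazurDoubleCancellation.lean`) and
`cancellingPosition_of_idealCircle_of_homotopic`.
[cite: Mazur1961, Theorem (W × I ≅ I⁵) and its Corollary (2W ≅ S⁴)] [cite: AitchisonRubinstein1984, Lemma 5.4] -/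
theorem Mazur1961_double_sphere_four_of_idealCircle_of_homotopic
    (hideal : ∀ (V : Type) [TopologicalSpace V] [T2Space V] [SecondCountableTopology V]
      [ChartedSpace (EuclideanHalfSpace (4 + 1)) V] [IsManifold (𝓡∂ (4 + 1)) ∞ V] [CompactSpace V]
      (g : V → ℝ), (Cobordism.ofBoundary 4 V).IsNiceMorseFunction g →
      ∀ (m p q : V), criticalSet (𝓡∂ (4 + 1)) g = {m, p, q} →
      morseIndex (𝓡∂ (4 + 1)) g m = 0 → morseIndex (𝓡∂ (4 + 1)) g p = 1 →
      morseIndex (𝓡∂ (4 + 1)) g q = 2 →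
      ∀ (ξ : Cₛ^∞⟮𝓡∂ (4 + 1); EuclideanSpace ℝ (Fin (4 + 1)),
          (TangentSpace (𝓡∂ (4 + 1)) : V → Type)⟯), IsGradientLike (𝓡∂ (4 + 1)) g ξ →
      ∀ (V₁ : Type) [TopologicalSpace V₁] [T2Space V₁] [SecondCountableTopology V₁]
        [CompactSpace V₁] [ChartedSpace (EuclideanSpace ℝ (Fin 4)) V₁] [IsManifold (𝓡 4) ∞ V₁]
        (ι₁ : V₁ → V), Manifold.IsSmoothEmbedding (𝓡 4) (𝓡∂ (4 + 1)) ∞ ι₁ →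
        range ι₁ = g ⁻¹' {Cobordism.plusLevel 4 1} →
      ∃ e : C((Metric.sphere (0 : EuclideanSpace ℝ (Fin 2)) 1), V₁), Manifold.IsSmoothEmbedding (𝓡 1) (𝓡 4) ∞ e ∧ ∃ x₀ : V,
        rightHandSphere (𝓡∂ (4 + 1)) g ξ p (Cobordism.plusLevel 4 1) ∩ (ι₁ '' range e) = {x₀} ∧
        IsTransverseInLevel (𝓡∂ (4 + 1)) (g ⁻¹' {Cobordism.plusLevel 4 1})
          (rightHandSphere (𝓡∂ (4 + 1)) g ξ p (Cobordism.plusLevel 4 1)) (ι₁ '' range e) x₀)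
    (hcrux : ∀ (V : Type) [TopologicalSpace V] [T2Space V] [SecondCountableTopology V]
      [ChartedSpace (EuclideanHalfSpace (4 + 1)) V] [IsManifold (𝓡∂ (4 + 1)) ∞ V] [CompactSpace V]
      [ContractibleSpace V] (g : V → ℝ), (Cobordism.ofBoundary 4 V).IsNiceMorseFunction g →
      ∀ (m p q : V), criticalSet (𝓡∂ (4 + 1)) g = {m, p, q} →
      morseIndex (𝓡∂ (4 + 1)) g m = 0 → morseIndex (𝓡∂ (4 + 1)) g p = 1 →
      morseIndex (𝓡∂ (4 + 1)) g q = 2 →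
      ∀ (ξ : Cₛ^∞⟮𝓡∂ (4 + 1); EuclideanSpace ℝ (Fin (4 + 1)),
          (TangentSpace (𝓡∂ (4 + 1)) : V → Type)⟯), IsGradientLike (𝓡∂ (4 + 1)) g ξ →
      ∀ (V₁ : Type) [TopologicalSpace V₁] [T2Space V₁] [SecondCountableTopology V₁]
        [CompactSpace V₁] [ChartedSpace (EuclideanSpace ℝ (Fin 4)) V₁] [IsManifold (𝓡 4) ∞ V₁]
        (ι₁ : V₁ → V), Manifold.IsSmoothEmbedding (𝓡 4) (𝓡∂ (4 + 1)) ∞ ι₁ →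
        range ι₁ = g ⁻¹' {Cobordism.plusLevel 4 1} →
      ∀ (e_C : C((Metric.sphere (0 : EuclideanSpace ℝ (Fin 2)) 1), V₁)), Manifold.IsSmoothEmbedding (𝓡 1) (𝓡 4) ∞ e_C →
        range (ι₁ ∘ e_C) = leftHandSphere (𝓡∂ (4 + 1)) g ξ q (Cobordism.plusLevel 4 1) →
      ∀ (e_S : C((Metric.sphere (0 : EuclideanSpace ℝ (Fin 2)) 1), V₁)), Manifold.IsSmoothEmbedding (𝓡 1) (𝓡 4) ∞ e_S → ∀ (x₀ : V),
        rightHandSphere (𝓡∂ (4 + 1)) g ξ p (Cobordism.plusLevel 4 1) ∩ (ι₁ '' range e_S) = {x₀} →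
        IsTransverseInLevel (𝓡∂ (4 + 1)) (g ⁻¹' {Cobordism.plusLevel 4 1})
          (rightHandSphere (𝓡∂ (4 + 1)) g ξ p (Cobordism.plusLevel 4 1)) (ι₁ '' range e_S) x₀ →
      ∃ e : C((Metric.sphere (0 : EuclideanSpace ℝ (Fin 2)) 1), V₁), Manifold.IsSmoothEmbedding (𝓡 1) (𝓡 4) ∞ e ∧ range e = range e_S ∧
        e_C.Homotopic e) :
    Mazur1961_double_sphere_four :=
  Mazur1961_double_sphere_four_of_cancellingPosition
    (fun V _ _ _ _ _ _ _ g hg m p q hcrit hm hp hq =>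
      cancellingPosition_of_idealCircle_of_homotopic hideal hcrux V g hg m p q hcrit hm hp hq)

end Literature.Topology.FourManifolds

end
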